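import Summits.QuantumFields.BalabanUV.Beta.GAN24.FibreRateFeed

/-!
# `BalabanUV.Beta.GAN24.FibreRateFeedFF` — binder row G-an2-4 / (CONV-C), road P1-fibre, leaf **P1-L11** `FibreRate` (Part B), PART F-ff: the FEED SHARE of
# the field–field leg (`Σ_{l′}(Σ_m R_φ)·φ_{l′} + (Σ_m R_c)·c`, i.e. reading-side sums × Cap⁻¹ × source-side sums) — two-level rate AS A FUNCTION of both sides' data

NOT IN PRINT; OUR PROOF ATTEMPT.  HONEST FRAMING (cell contract, verbatim): «discharging `BetaPertH` makes Bałaban's UV stability UNCONDITIONAL — a real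
constructive-QFT result; it is NOT the continuum limit and NOT the Clay problem.»  HONEST DEPENDENCY (verbatim): «continuum YM on T⁴ ⇐ BetaPertH ∧ nine spine
estimates (0/9 proved); BetaPertH ⇐ (D1) ∧ (D4) ∧ CAP+tail; G-an2-4 gates asym, D1 and NE2/3/4.»  [folklore] two-factor telescoping
(`ClosedFormRateOfParts.norm_mul_sub_mul_le_of_bounds`, leaf-11) of the reading-side sums (leaf-11's `rPhiTerm`/`rCTerm`) against this seat's scaled
`(φ, c)` bounds/rates (`FibreRateMF.norm_scaled_phiSol_sub_le`, `FibreRateFeed.norm_scaled_phiSol_le/…cSol_le/…cSol_sub_le`); no cited fact, no wall binder,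
no `def`, no `def … : Prop` hypothesis (both sides' bounds/rates are ORDINARY HYPOTHESES; PART S, leaf-07-g6, supplies them).  NOT summit progress: a piece of
shape (I2′); nothing of (CONV-C)'s K-slot is discharged; 0 wall binders instantiated; NOT `BetaPertH`, NOT continuum, NOT Clay.

## What is proved (every `D`, `1 ≤ N ≤ N′`, real `q ∈ [−π, π]^D ∖ {0}`)
* `scaled_feed_eq`: `N⁻³N^{D+1}·feed = Σ_{l′}(N⁻³Σ_m R_φ)(N^{D+1}φ_{l′}) + (N⁻³Σ_m R_c)(N^{D+1}c)` (every complex `p`);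
* **`norm_scaled_feed_sub_le`**: from reading-side data `(A_φ, A_c; Q_φ, Q_c)` at leg `(κ, x′)` and source-side data `(B_φ, B_c; R_φ, R_c)` for the forces
  `f̂, f̂′`: `‖Δ(N⁻³N^{D+1}·feed)‖ ≤ (D(Q_φ·BΦ + A_φ·KΦ) + Q_c·BC + A_c·KC)/N²` with `BΦ, BC` the scaled `(φ, c)` bounds and `KΦ, KC` their rates (displayed
  in the statement).  At `d = 3` the unit `sfStep Lc j² = N²/Lc²` makes `sf_j²·feed_j = Lc⁻²·(N⁻³N⁵·feed_j)`; with leaf-11's T-share (`ff_summand_split`,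
  `FibreRateFeed.sum_readW_Ahat_fhatF`, `FibreRateTBlockSum.norm_tSum_step_le`) this is the `hff` hypothesis of `FibreRateOfLegs.realRateK_of_leg_rates` — the
  final assembly's business.

Unit `b2b-balaban-gan24-formalise-leaf-20` (G-an2-4 formalisation swarm, leaf prover 20), 2026-08-20.  Value = kernel assembly leaf toward the K-slot route P1,
NOT summit progress.
-/

noncomputable section

open Complex Finset
open scoped BigOperators Real

namespace Summit.QuantumFields.BalabanUV.Beta.GAN24.FibreRateFeedFF

open Literature.MathematicalPhysics.QuantumFieldTheory.Balaban1983to89.B4Strip (ofRealVec)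
open Literature.MathematicalPhysics.QuantumFieldTheory.King1986 (momSq momSq_nonneg)

/-! ## §4 The ff feed share `Σ_{l′}(Σ_m R_φ)·φ_{l′} + (Σ_m R_c)·c`: scaled form and two-level rate as a function of both sides' data -/

section FF
open Literature.Probability.LatticeModels (TorusSite)
open AliasObjects (cap phiSol cSol srcPhi srcC readW Ahat fhatF)
open FibreRateFeedTerms (rPhiTerm rCTerm)
open CapacitanceEndpointBlocks (cPP cPc ccc)
open CapacitanceRateScaled (crPP crPc crcc)
open FibreRateMF (norm_scaled_phiSol_sub_le)
open FibreRateFeed (norm_scaled_phiSol_le norm_scaled_cSol_le norm_scaled_cSol_sub_le)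

variable {D : ℕ}

/-- [folklore] The ff FEED SHARE of the readout at level `N` (force `f̂`, zero constraint source), written with leaf-11's reading-side summands:
`feed = Σ_{l′} (Σ_m R_φ(m;κ,l′;x′))·φ_{l′} + (Σ_m R_c(m;κ;x′))·c`.  SCALED FORM:
`N⁻³·N^{D+1}·feed = Σ_{l′} (N⁻³Σ_m R_φ)·(N^{D+1}φ_{l′}) + (N⁻³Σ_m R_c)·(N^{D+1}c)`. -/
theorem scaled_feed_eq {N : ℕ} [NeZero N] (M : ℕ) (p : Fin D → ℂ) (fhat : TorusSite D N → Fin D → ℂ) (κ : Fin D) (x' : Fin D → ℤ) :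
    (((N : ℂ) ^ 3)⁻¹) * ((N : ℂ) ^ (D + 1) *
        (∑ l', (∑ m, rPhiTerm N M p m κ l' x') * phiSol N p fhat 0 l' + (∑ m, rCTerm N M p m κ x') * cSol N p fhat 0))
      = ∑ l', ((((N : ℂ) ^ 3)⁻¹) * ∑ m, rPhiTerm N M p m κ l' x') * ((N : ℂ) ^ (D + 1) * phiSol N p fhat 0 l')
        + ((((N : ℂ) ^ 3)⁻¹) * ∑ m, rCTerm N M p m κ x') * ((N : ℂ) ^ (D + 1) * cSol N p fhat 0) := by
  rw [mul_add, mul_add, Finset.mul_sum, Finset.mul_sum]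
  congr 1
  · exact Finset.sum_congr rfl fun l' _ => by ring
  · ring

variable {N N' : ℕ} [NeZero N] [NeZero N'] {q : Fin D → ℝ}

/-- **TWO-LEVEL RATE OF THE SCALED ff FEED SHARE, AS A FUNCTION OF THE READING- AND SOURCE-SIDE DATA** [folklore] (`1 ≤ N ≤ N′`,
`q ∈ [−π, π]^D ∖ {0}`): reading side at leg `(κ, x′)` — bounds `A_φ, A_c` (level `N`), rates `Q_φ/N², Q_c/N²`; source side for the forces `f̂` (level `N`),
`f̂′` (level `N′`) — bounds `B_φ, B_c` (level `N′`), rates `R_φ/N², R_c/N²`; then with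
`BΦ = D·cPP|q|²B_φ + cPc|q|²√|q|²B_c`, `BC = D·cPc|q|²√|q|²B_φ + ccc|q|⁴B_c` (scaled `(φ, c)` bounds) and
`KΦ = D(crPP|q|⁴B_φ + cPP|q|²R_φ) + crPc|q|⁴√|q|²B_c + cPc|q|²√|q|²R_c`, `KC = D(crPc|q|⁴√|q|²B_φ + cPc|q|²√|q|²R_φ) + crcc|q|⁶B_c + ccc|q|⁴R_c`
(their rates): `‖Δ(N⁻³N^{D+1}·feed)‖ ≤ (D·(Q_φ·BΦ + A_φ·KΦ) + Q_c·BC + A_c·KC)/N²`. -/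
theorem norm_scaled_feed_sub_le (hN : 1 ≤ N) (hNN' : N ≤ N') (hq : ∀ i, |q i| ≤ π) (hq0 : q ≠ 0) (M M' : ℕ)
    {fhat : TorusSite D N → Fin D → ℂ} {fhat' : TorusSite D N' → Fin D → ℂ} (κ : Fin D) (x' : Fin D → ℤ)
    {Aφ Ac Qφ Qc Bφ Bc Rφ Rc : ℝ}
    (hAφ : ∀ l', ‖(((N : ℂ) ^ 3)⁻¹) * ∑ m, rPhiTerm N M (ofRealVec q) m κ l' x'‖ ≤ Aφ)
    (hAc : ‖(((N : ℂ) ^ 3)⁻¹) * ∑ m, rCTerm N M (ofRealVec q) m κ x'‖ ≤ Ac)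
    (hQφ : ∀ l', ‖(((N' : ℂ) ^ 3)⁻¹) * ∑ m, rPhiTerm N' M' (ofRealVec q) m κ l' x' - (((N : ℂ) ^ 3)⁻¹) * ∑ m, rPhiTerm N M (ofRealVec q) m κ l' x'‖
      ≤ Qφ / (N : ℝ) ^ 2)
    (hQc : ‖(((N' : ℂ) ^ 3)⁻¹) * ∑ m, rCTerm N' M' (ofRealVec q) m κ x' - (((N : ℂ) ^ 3)⁻¹) * ∑ m, rCTerm N M (ofRealVec q) m κ x'‖
      ≤ Qc / (N : ℝ) ^ 2)
    (hBφ : ∀ l', ‖(((N' : ℂ) ^ 3)⁻¹) * srcPhi N' (ofRealVec q) fhat' 0 l'‖ ≤ Bφ)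
    (hBc : ‖(((N' : ℂ) ^ 3)⁻¹) * srcC N' (ofRealVec q) fhat'‖ ≤ Bc)
    (hRφ : ∀ l', ‖(((N' : ℂ) ^ 3)⁻¹) * srcPhi N' (ofRealVec q) fhat' 0 l' - (((N : ℂ) ^ 3)⁻¹) * srcPhi N (ofRealVec q) fhat 0 l'‖ ≤ Rφ / (N : ℝ) ^ 2)
    (hRc : ‖(((N' : ℂ) ^ 3)⁻¹) * srcC N' (ofRealVec q) fhat' - (((N : ℂ) ^ 3)⁻¹) * srcC N (ofRealVec q) fhat‖ ≤ Rc / (N : ℝ) ^ 2) :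
    ‖(((N' : ℂ) ^ 3)⁻¹) * ((N' : ℂ) ^ (D + 1) *
          (∑ l', (∑ m, rPhiTerm N' M' (ofRealVec q) m κ l' x') * phiSol N' (ofRealVec q) fhat' 0 l'
            + (∑ m, rCTerm N' M' (ofRealVec q) m κ x') * cSol N' (ofRealVec q) fhat' 0))
        - (((N : ℂ) ^ 3)⁻¹) * ((N : ℂ) ^ (D + 1) *
          (∑ l', (∑ m, rPhiTerm N M (ofRealVec q) m κ l' x') * phiSol N (ofRealVec q) fhat 0 l'
            + (∑ m, rCTerm N M (ofRealVec q) m κ x') * cSol N (ofRealVec q) fhat 0))‖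
      ≤ (D * (Qφ * (D * (cPP D * momSq q * Bφ) + cPc D * (momSq q * Real.sqrt (momSq q)) * Bc)
              + Aφ * (D * (crPP D * momSq q ^ 2 * Bφ + cPP D * momSq q * Rφ)
                + crPc D * (momSq q ^ 2 * Real.sqrt (momSq q)) * Bc + cPc D * (momSq q * Real.sqrt (momSq q)) * Rc))
          + Qc * (D * (cPc D * (momSq q * Real.sqrt (momSq q)) * Bφ) + ccc D * momSq q ^ 2 * Bc)
          + Ac * (D * (crPc D * (momSq q ^ 2 * Real.sqrt (momSq q)) * Bφ + cPc D * (momSq q * Real.sqrt (momSq q)) * Rφ)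
                + crcc D * momSq q ^ 3 * Bc + ccc D * momSq q ^ 2 * Rc)) / (N : ℝ) ^ 2 := by
  have hN' : 1 ≤ N' := hN.trans hNN'
  have hN0 : (0 : ℝ) < N := by exact_mod_cast hN
  rw [scaled_feed_eq, scaled_feed_eq, show ∀ (a b c e : ℂ), (a + b) - (c + e) = (a - c) + (b - e) from fun _ _ _ _ => by ring,
    ← Finset.sum_sub_distrib]
  -- scaled (φ, c) data at level N′ and their rates
  have hΦ' : ∀ l', ‖(N' : ℂ) ^ (D + 1) * phiSol N' (ofRealVec q) fhat' 0 l'‖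
      ≤ D * (cPP D * momSq q * Bφ) + cPc D * (momSq q * Real.sqrt (momSq q)) * Bc :=
    fun l' => norm_scaled_phiSol_le hN' hq hq0 hBφ hBc l'
  have hΔΦ : ∀ l', ‖(N' : ℂ) ^ (D + 1) * phiSol N' (ofRealVec q) fhat' 0 l' - (N : ℂ) ^ (D + 1) * phiSol N (ofRealVec q) fhat 0 l'‖
      ≤ (D * (crPP D * momSq q ^ 2 * Bφ + cPP D * momSq q * Rφ)
          + crPc D * (momSq q ^ 2 * Real.sqrt (momSq q)) * Bc + cPc D * (momSq q * Real.sqrt (momSq q)) * Rc) / (N : ℝ) ^ 2 :=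
    fun l' => norm_scaled_phiSol_sub_le hN hNN' hq hq0 hBφ hBc hRφ hRc l'
  have hC' : ‖(N' : ℂ) ^ (D + 1) * cSol N' (ofRealVec q) fhat' 0‖ ≤ D * (cPc D * (momSq q * Real.sqrt (momSq q)) * Bφ) + ccc D * momSq q ^ 2 * Bc :=
    norm_scaled_cSol_le hN' hq hq0 hBφ hBc
  have hΔC : ‖(N' : ℂ) ^ (D + 1) * cSol N' (ofRealVec q) fhat' 0 - (N : ℂ) ^ (D + 1) * cSol N (ofRealVec q) fhat 0‖
      ≤ (D * (crPc D * (momSq q ^ 2 * Real.sqrt (momSq q)) * Bφ + cPc D * (momSq q * Real.sqrt (momSq q)) * Rφ)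
          + crcc D * momSq q ^ 3 * Bc + ccc D * momSq q ^ 2 * Rc) / (N : ℝ) ^ 2 :=
    norm_scaled_cSol_sub_le hN hNN' hq hq0 hBφ hBc hRφ hRc
  refine (norm_add_le _ _).trans ?_
  have hsum := (norm_sum_le (Finset.univ : Finset (Fin D)) _).trans (Finset.sum_le_sum fun l' (_ : l' ∈ Finset.univ) =>
    ClosedFormRateOfParts.norm_mul_sub_mul_le_of_bounds (hAφ l') (hΦ' l') (hQφ l') (hΔΦ l'))
  have hc := ClosedFormRateOfParts.norm_mul_sub_mul_le_of_bounds hAc hC' hQc hΔC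
  refine (add_le_add hsum hc).trans (le_of_eq ?_)
  rw [Finset.sum_const, Finset.card_univ, Fintype.card_fin, nsmul_eq_mul]
  field_simp
  ring

end FF

end Summit.QuantumFields.BalabanUV.Beta.GAN24.FibreRateFeedFF

end
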